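import Summits.QuantumFields.YangMills.Theorems.LevelShiftBootstrapHistoryTailOfLocalStabilityTransport
import Summits.QuantumFields.YangMills.Theorems.LevelShiftBootstrapHistoryTailOfLocalStabilityMeasureChain
import Summits.QuantumFields.YangMills.Theorems.LevelShiftBootstrapHistoryTailOfLocalStabilityThresholds
import Summits.QuantumFields.YangMills.Theorems.UnitScaleTiltHistoryTailBoundedHeight
import Summits.QuantumFields.YangMills.Theorems.SmallFieldWideningLargeFieldMassRefinementTailFreeTopSteps

/-!
# The level-shift bootstrap, part 5: THE INDUCTION — from the local cross-ratio stability of the unit tails along the cut-off (the clause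
# of crux `LocalUnitStabilityL`, stmt-QuantumFields-27016, for every refinement of one family) to a Gaussian per-plaquette large-field tail at
# EVERY height of that family, uniformly in the run — helper toward `LevelShiftBootstrap.HistoryTailOfLocalStability` (stmt-QuantumFields-26949)

Width seat `ym-line-sfw-p2-w3` g22 (home cell `ym-idea-1`), `--supports stmt-QuantumFields-26949`.  Route-independent (no `Theses` import): the
crux enters as the hypothesis `hcrux`, its clause for every family of block size `F.L` at every coupling `≤ γ₁` (= `LocalUnitStabilityL` after
its outer choices; instantiated in the closing file).

THE ARGUMENT (★ `perPlaquette_tail_of_crossRatio`).  Fix a family `F` and `0 < γ ≤ 1`; write `u(h, j)` for the largest Gibbs mass, over the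
plaquettes `q` of level `j` of run `j + h`, of «`θ_{c b₀}(h) ≤ |Ū^{j}(∂q) − 1|`» — by the level shift (part 2) the unit tail of run `j` of `F.refine h`.
CLAIM: `u(h, j) ≤ B_h := 3e^{R_h+1}A_h` for all `j` and all `h ≥ h₀(F, γ)`, where `A_h = C₁β_h^A e^{−a p_h²}` is the landed bounded-height brute force
(`unitScaleTilt_perPlaquette_boundedHeight`, `j₀ := m̄`, profile `c b₀/2`, applied ONCE to `F`) and `R_h = R·p_h·(m + h + 1)^q` the crux's slack for
`F.refine h`.  Strong induction on `j`: for `j ≤ m̄` brute force; for `j > m̄` the chain of part 3 on `F.refine h` from `J = m̄` to `j` (the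
thresholds `τ_J θ` telescope; the base at `τ ≥ ½` is brute force at profile `c b₀/2`), whose conditioning defects — complements of the interior
events of runs `J`, `J + 1` — are by part 2 sums of `u(h + i, J − i)`, `i ≥ ⌊J/m̄⌋ ≥ 1`, i.e. unit tails of DEEPER refinements at SMALLER cut-offs
(induction hypothesis), and by part 4 (`h ≥ h₀`) these total `≤ A_h ≤ ½`.  Output (`h < h₀`: trivial bound `1`, absorbed into the constant):
`Gibbs_K{θ_{c b₀}(K − j) ≤ |Ū^{j}(∂q) − 1|} ≤ C·β_{K−j}^A·exp(−a'·p_{c b₀}(g_{K−j})²)` for ALL `K, j ≤ K, q`.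

HONEST FRAMING.  No estimate of Bałaban's is asserted: the cross-ratio stability is a HYPOTHESIS (crux 27016, open, XL); rung R3 is a RECORD rung —
no summit, no Clay claim; the Yang–Mills mass gap is NOT proved by any of this.  No `def`, no `sorry`.

References: C. King, CMP **102** (1986) 649–677 [King1986] (Thm 3.4 p.656); T. Bałaban, CMP **102** (1985) 255–275 [Balaban1985UV3] ((7) p.257,
(71) p.273); J. Fröhlich, R. Israel, E. Lieb, B. Simon, CMP **62** (1978) 1–34 [FrohlichIsraelLiebSimon1978] (chessboard estimate behind the base).
-/

set_option autoImplicit false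

noncomputable section

open MeasureTheory Filter
open scoped BigOperators
open Literature.MathematicalPhysics.QuantumFieldTheory
open Literature.MathematicalPhysics.QuantumFieldTheory.Balaban1983to89
open Literature.MathematicalPhysics.QuantumFieldTheory.Balaban1983to89.T3ContinuumYM3Torus
open Literature.MathematicalPhysics.QuantumFieldTheory.Balaban1983to89.T3UnitScaleTilt
open Literature.MathematicalPhysics.QuantumFieldTheory.Balaban1983to89.T3UnitLawDensityEML
open Literature.MathematicalPhysics.QuantumFieldTheory.Balaban1983to89.T3LevelShift
open Literature.MathematicalPhysics.QuantumFieldTheory.Balaban1983to89.T3ThresholdRemoval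
open Literature.MathematicalPhysics.QuantumFieldTheory.Balaban1983to89.T3InteriorExcision
open Summit.QuantumFields.YangMills.Theorems.LargeFieldMassRefinementTailOfHeightTail (θBal_mul_pow)
open Summit.QuantumFields.YangMills.Theorems.RenyiTelescope (sitesPerDir_level_refine_unit)
open Summit.QuantumFields.YangMills.Theorems.HistoryTailBoundedHeight (unitScaleTilt_perPlaquette_boundedHeight)
open Summit.QuantumFields.YangMills.Theorems.LargeFieldMassRefinementTailFreeTopSteps (eventually_coupling_le)

namespace Summit.QuantumFields.YangMills.Theorems.HistoryTailOfLocalStability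

/-- Bałaban's profile is linear in `b₀`. [cite: Balaban1985UV3, (7) p.257] -/
theorem pFun_mul (k b₀ p₀ g : ℝ) : B10.pFun (k * b₀) p₀ g = k * B10.pFun b₀ p₀ g := by
  unfold B10.pFun; ring

/-- ★ **THE LEVEL-SHIFT BOOTSTRAP** (module docstring): the crux's cross-ratio clause for every family of block size `F.L` at every coupling `≤ γ₁`
yields, for the family `F` at `0 < γ ≤ 1`, a Gaussian per-plaquette large-field tail at every height, uniformly in the run.
[cite: King1986, Thm 3.4 (3.9)-(3.13) p.656; Balaban1985UV3, (7) p.257 and (71) p.273] -/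
theorem perPlaquette_tail_of_crossRatio (F : T3Family) {γ γ₁ R b₀ c : ℝ} {q mbar P : ℕ}
    (hγ : 0 < γ) (hγ1 : γ ≤ 1) (hγ₁ : 0 < γ₁) (hR : 0 ≤ R) (hb₀ : 0 < b₀) (hc : 0 < c) (hc1 : c ≤ 1) (hm : 0 < mbar)
    (hP : q + 2 ≤ P)
    (hcrux : ∀ (F' : T3Family) (γ' : ℝ), F'.L = F.L → 0 < γ' → γ' ≤ γ₁ →
      ∃ (ρ τ : ℕ → ℝ), (∀ J, 0 ≤ ρ J) ∧ (∀ J, 1 / 2 ≤ τ J ∧ τ J ≤ 1) ∧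
        (∀ N, ∑ J ∈ Finset.range N, ρ J ≤ R * B10.pFun b₀ (P : ℝ) (Real.sqrt γ') * ((F'.m : ℝ) + 1) ^ q) ∧
        ∀ (J : ℕ) (p : Plaq (F'.P 0) 0), mbar ≤ J →
          (gibbsK F' ℰp γ' (J + 1)).real ((unitA F' ℰp (J + 1)) ⁻¹'
              {V | τ (J + 1) * θBal F.L γ' (c * b₀) (P : ℝ) 0 ≤ GaugeGroup.dist1 (GaugeField.plaqHol V p)} ∩
            histGoodInt F' (θBal F.L γ' b₀ (P : ℝ)) (θBal F.L γ' (c * b₀) (P : ℝ) (J / mbar)) (J + 1) (J / mbar)) *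
          (gibbsK F' ℰp γ' J).real
            (histGoodInt F' (θBal F.L γ' b₀ (P : ℝ)) (θBal F.L γ' (c * b₀) (P : ℝ) (J / mbar)) J (J / mbar)) ≤
          Real.exp (ρ J) * (gibbsK F' ℰp γ' J).real ((unitA F' ℰp J) ⁻¹'
              {V | τ J * θBal F.L γ' (c * b₀) (P : ℝ) 0 ≤ GaugeGroup.dist1 (GaugeField.plaqHol V p)} ∩
            histGoodInt F' (θBal F.L γ' b₀ (P : ℝ)) (θBal F.L γ' (c * b₀) (P : ℝ) (J / mbar)) J (J / mbar)) *
          (gibbsK F' ℰp γ' (J + 1)).real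
            (histGoodInt F' (θBal F.L γ' b₀ (P : ℝ)) (θBal F.L γ' (c * b₀) (P : ℝ) (J / mbar)) (J + 1) (J / mbar))) :
    ∃ (C : ℝ) (A : ℕ) (a : ℝ), 0 ≤ C ∧ 0 < a ∧ ∀ (K j : ℕ), j ≤ K → ∀ qq : Plaq (F.P K) j,
      (gibbsK F ℰp γ K).real
          {U | θBal F.L γ (c * b₀) (P : ℝ) (K - j) ≤ GaugeGroup.dist1 (GaugeField.plaqHol
            (Averaging.iter (fun i => BlockAveraging.blockAvg (P := F.P K) (j := i) ℰp) j U) qq)} ≤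
        C * (γ * ((F.L : ℝ)⁻¹) ^ (K - j))⁻¹ ^ A *
          Real.exp (-(a * B10.pFun (c * b₀) (P : ℝ) (Real.sqrt (γ * ((F.L : ℝ)⁻¹) ^ (K - j))) ^ 2)) := by
  have hL1 : 1 < F.L := F.hL.2
  have hL0 : 0 < F.L := by omega
  have hLr : (0 : ℝ) < F.L := by exact_mod_cast hL0
  have hLr1 : (1 : ℝ) ≤ F.L := by exact_mod_cast hL1.le
  haveI hprobF : ∀ K, IsProbabilityMeasure (gibbsK F ℰp γ K) := fun K => isProbabilityMeasure_gibbsK F ℰp hγ.le K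
  -- the profile along the depth
  obtain ⟨x₀, hx₀def⟩ : ∃ x₀ : ℝ, x₀ = 1 - Real.log γ / 2 := ⟨_, rfl⟩
  obtain ⟨δ, hδdef⟩ : ∃ δ : ℝ, δ = Real.log F.L / 2 := ⟨_, rfl⟩
  have hx₀ : 1 ≤ x₀ := by rw [hx₀def]; exact one_le_offset hγ hγ1
  have hδ : 0 < δ := by rw [hδdef]; exact step_pos hL1
  obtain ⟨p_, hp⟩ : ∃ p_ : ℕ → ℝ, ∀ i, p_ i = b₀ * (x₀ + δ * i) ^ P := ⟨_, fun _ => rfl⟩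
  have hp_eq : ∀ i, B10.pFun b₀ (P : ℝ) (Real.sqrt (γ * ((F.L : ℝ)⁻¹) ^ i)) = p_ i := fun i => by
    rw [pFun_sqrt_eq hγ hL0 b₀ P i, hp, hx₀def, hδdef]
  have hp0 : ∀ i, 0 ≤ p_ i := fun i => by
    rw [hp]; have : 0 ≤ x₀ + δ * i := by positivity
    positivity
  have hpmono : ∀ i i', i ≤ i' → p_ i ≤ p_ i' := fun i i' hii' => by
    rw [hp, hp]; exact profile_mono (by linarith) hδ.le hb₀.le hii'
  -- the brute-force base of the base family at profile `c b₀ / 2`, heights `≤ mbar`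
  obtain ⟨C₀, A, cbf, hC₀, hcbf, hbase⟩ :=
    unitScaleTilt_perPlaquette_boundedHeight mbar F hγ hγ1 (b₀ := 2⁻¹ * c * b₀) (by positivity) (P : ℝ)
  obtain ⟨C₁, hC₁def⟩ : ∃ C₁ : ℝ, C₁ = C₀ + 1 := ⟨_, rfl⟩
  have hC₁ : 0 < C₁ := by rw [hC₁def]; linarith
  have hC₀₁ : C₀ ≤ C₁ := by rw [hC₁def]; linarith
  obtain ⟨a, hadef⟩ : ∃ a : ℝ, a = cbf * (2⁻¹ * c) ^ 2 := ⟨_, rfl⟩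
  have ha : 0 < a := by rw [hadef]; positivity
  -- the functions of the depth
  obtain ⟨Rt, hRt⟩ : ∃ Rt : ℕ → ℝ, ∀ i, Rt i = R * p_ i * ((F.m : ℝ) + i + 1) ^ q := ⟨_, fun _ => rfl⟩
  obtain ⟨A_, hA⟩ : ∃ A_ : ℕ → ℝ, ∀ i,
      A_ i = C₁ * Real.exp (A * (i * Real.log F.L - Real.log γ)) * Real.exp (-(a * p_ i ^ 2)) := ⟨_, fun _ => rfl⟩
  obtain ⟨B_, hB⟩ : ∃ B_ : ℕ → ℝ, ∀ i, B_ i = 3 * Real.exp (Rt i + 1) * A_ i := ⟨_, fun _ => rfl⟩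
  obtain ⟨W_, hW⟩ : ∃ W_ : ℕ → ℝ, ∀ i, W_ i = 72 * (F.L : ℝ) ^ (3 * F.m) * ((F.L : ℝ) ^ i) ^ 3 * B_ i :=
    ⟨_, fun _ => rfl⟩
  have hRt0 : ∀ i, 0 ≤ Rt i := fun i => by rw [hRt]; have := hp0 i; positivity
  have hA0 : ∀ i, 0 < A_ i := fun i => by rw [hA]; positivity
  have hexp1 : ∀ i, 1 ≤ Real.exp (Rt i + 1) := fun i => Real.one_le_exp (by linarith [hRt0 i])
  have hAB : ∀ i, A_ i ≤ B_ i := fun i => by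
    rw [hB]; have := hA0 i; nlinarith [hexp1 i]
  have hB0 : ∀ i, 0 ≤ B_ i := fun i => (hA0 i).le.trans (hAB i)
  have hW0 : ∀ i, 0 ≤ W_ i := fun i => by rw [hW]; have := hB0 i; positivity
  -- `β_i = (γL^{-i})⁻¹ = exp(i log L − log γ) ≥ 1`
  have hβexp : ∀ i : ℕ, (γ * ((F.L : ℝ)⁻¹) ^ i)⁻¹ = Real.exp ((i : ℝ) * Real.log F.L - Real.log γ) :=
    fun i => inv_coupling_eq_exp hγ hL0 i
  have hβ1 : ∀ i : ℕ, (1 : ℝ) ≤ (γ * ((F.L : ℝ)⁻¹) ^ i)⁻¹ := fun i => by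
    have h1 : γ * ((F.L : ℝ)⁻¹) ^ i ≤ 1 :=
      (mul_le_of_le_one_right hγ.le (pow_le_one₀ (inv_nonneg.mpr hLr.le) (inv_le_one_of_one_le₀ hLr1))).trans hγ1
    have h2 : 0 < γ * ((F.L : ℝ)⁻¹) ^ i := mul_pos hγ (pow_pos (inv_pos.mpr hLr) i)
    exact (one_le_inv₀ h2).mpr h1
  -- the thresholds
  obtain ⟨h₀', hC2, hC3, hC4, hC5⟩ := exists_depth_threshold (L := F.L) (γ := γ) (mF := F.m) (mbar := mbar) (A := A)
    hL1 hx₀ hδ ha hb₀ hR hC₁ hm hP hp hRt hA hB hW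
  obtain ⟨h₁, hC1⟩ : ∃ h₁ : ℕ, ∀ h, h₁ ≤ h → γ * ((F.L : ℝ)⁻¹) ^ h ≤ γ₁ :=
    Filter.eventually_atTop.mp (eventually_coupling_le F γ hγ₁)
  obtain ⟨h₀, hh₀def⟩ : ∃ h₀ : ℕ, h₀ = max h₀' h₁ := ⟨_, rfl⟩
  have hh₀' : h₀' ≤ h₀ := by rw [hh₀def]; exact le_max_left _ _
  have hh₁ : h₁ ≤ h₀ := by rw [hh₀def]; exact le_max_right _ _
  -- `θBal` facts
  have hθ0 : ∀ i, 0 ≤ θBal F.L γ (c * b₀) (P : ℝ) i :=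
    fun i => HistoryTailBoundedHeight.θBal_nonneg' F hγ hγ1 (by positivity) (P : ℝ) i
  have hθhalf : ∀ i, θBal F.L γ (2⁻¹ * c * b₀) (P : ℝ) i = 2⁻¹ * θBal F.L γ (c * b₀) (P : ℝ) i := fun i => by
    rw [show 2⁻¹ * c * b₀ = 2⁻¹ * (c * b₀) by ring, θBal_mul]
  -- the base in our currency
  have hbaseA : ∀ (K j : ℕ), j ≤ K → j ≤ mbar → ∀ qq : Plaq (F.P K) j,
      (gibbsK F ℰp γ K).real
          {U | 2⁻¹ * θBal F.L γ (c * b₀) (P : ℝ) (K - j) ≤ GaugeGroup.dist1 (GaugeField.plaqHol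
            (Averaging.iter (fun i => BlockAveraging.blockAvg (P := F.P K) (j := i) ℰp) j U) qq)} ≤ A_ (K - j) := by
    intro K j hjK hjm qq
    have h1 := hbase K j hjK hjm qq
    rw [hθhalf] at h1
    refine h1.trans ?_
    have hpf : B10.pFun (2⁻¹ * c * b₀) (P : ℝ) (Real.sqrt (γ * ((F.L : ℝ)⁻¹) ^ (K - j))) = 2⁻¹ * c * p_ (K - j) := by
      rw [pFun_mul, hp_eq]
    have hβ : (F.scheme ℰp γ).β (K - j) ^ A = Real.exp (A * ((K - j : ℕ) * Real.log F.L - Real.log γ)) := by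
      rw [show (F.scheme ℰp γ).β (K - j) = (γ * ((F.L : ℝ)⁻¹) ^ (K - j))⁻¹ from rfl, hβexp, ← Real.exp_nat_mul]
    rw [hpf, hβ, hA, show cbf * (2⁻¹ * c * p_ (K - j)) ^ 2 = a * p_ (K - j) ^ 2 by rw [hadef]; ring]
    exact mul_le_mul_of_nonneg_right (mul_le_mul_of_nonneg_right hC₀₁ (Real.exp_pos _).le) (Real.exp_pos _).le
  -- THE CLAIM: for every level `j`, every run `K ≥ j` at depth `K − j ≥ h₀` and every plaquette, the tail is `≤ B_{K−j}`
  have claim : ∀ j K : ℕ, j ≤ K → h₀ ≤ K - j → ∀ qq : Plaq (F.P K) j,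
      (gibbsK F ℰp γ K).real
          {U | θBal F.L γ (c * b₀) (P : ℝ) (K - j) ≤ GaugeGroup.dist1 (GaugeField.plaqHol
            (Averaging.iter (fun i => BlockAveraging.blockAvg (P := F.P K) (j := i) ℰp) j U) qq)} ≤ B_ (K - j) := by
    intro j
    induction j using Nat.strong_induction_on with
    | _ j IH => ?_
    intro K hjK hh qq
    obtain ⟨h, rfl⟩ : ∃ h, K = j + h := ⟨K - j, by omega⟩
    have hKj : j + h - j = h := Nat.add_sub_cancel_left j h
    rw [hKj] at hh ⊢
    have hh' : h₀' ≤ h := hh₀'.trans hh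
    by_cases hjm : j ≤ mbar
    · -- the base: bounded height, brute force
      have h1 := hbaseA (j + h) j (Nat.le_add_right j h) hjm qq
      rw [hKj] at h1
      refine le_trans (le_trans (measureReal_mono (fun U hU => ?_) (measure_ne_top _ _)) h1) (hAB h)
      have hU' : θBal F.L γ (c * b₀) (P : ℝ) h ≤ GaugeGroup.dist1 (GaugeField.plaqHol
          (Averaging.iter (fun i => BlockAveraging.blockAvg (P := F.P (j + h)) (j := i) ℰp) j U) qq) := hU
      show 2⁻¹ * θBal F.L γ (c * b₀) (P : ℝ) h ≤ _
      linarith [hθ0 h]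
    · -- the step: the chain on the refined family `F.refine h`
      have hmj : mbar ≤ j := by omega
      have hγh0 : 0 < γ * ((F.L : ℝ)⁻¹) ^ h := mul_pos hγ (pow_pos (inv_pos.mpr hLr) h)
      have hγh1 : γ * ((F.L : ℝ)⁻¹) ^ h ≤ γ₁ := hC1 h (hh₁.trans hh)
      obtain ⟨ρ, τ, hρ0, hτ, hρsum, hstep⟩ := hcrux (F.refine h) (γ * ((F.L : ℝ)⁻¹) ^ h) rfl hγh0 hγh1
      haveI hprob : ∀ J, IsProbabilityMeasure (gibbsK (F.refine h) ℰp (γ * ((F.L : ℝ)⁻¹) ^ h) J) :=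
        fun J => isProbabilityMeasure_gibbsK (F.refine h) ℰp hγh0.le J
      obtain ⟨θ, hθdef⟩ : ∃ θ : ℝ, θ = θBal F.L γ (c * b₀) (P : ℝ) h := ⟨_, rfl⟩
      have hθ0' : 0 ≤ θ := by rw [hθdef]; exact hθ0 h
      have hθh : θBal F.L (γ * ((F.L : ℝ)⁻¹) ^ h) (c * b₀) (P : ℝ) 0 = θ := by rw [θBal_mul_pow, Nat.zero_add, hθdef]
      rw [← hθdef]
      -- the unit plaquette of `F.refine h` under `qq`, and the level shift of the target event
      obtain ⟨pp, hppdef⟩ : ∃ pp : Plaq ((F.refine h).P 0) 0, pp = plaqShift (sitesPerDir_level_refine_unit F h j) qq := ⟨_, rfl⟩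
      rw [gibbsK_real_unitEvent_eq_refine F hγ.le h j θ qq, ← hppdef]
      -- THE CONDITIONING DEFECTS are unit tails of deeper refinements at smaller cut-offs (induction hypothesis + part 2 + part 4)
      have hdefect : ∀ J' n : ℕ, 1 ≤ n → n ≤ J' → J' - n < j →
          (gibbsK (F.refine h) ℰp (γ * ((F.L : ℝ)⁻¹) ^ h) J').real
              (histGoodInt (F.refine h) (θBal F.L (γ * ((F.L : ℝ)⁻¹) ^ h) b₀ (P : ℝ))
                (θBal F.L (γ * ((F.L : ℝ)⁻¹) ^ h) (c * b₀) (P : ℝ) n) J' n)ᶜ ≤ 7 / 3 * W_ (h + n) := by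
        intro J' n hn1 hnJ hJn
        refine (refine_real_compl_histGoodInt_le F hγ hγ1 hb₀ hc1 (P : ℝ) h J' n hnJ).trans
          (defect_le (J := J') (n := n) (h := h) hW0 hC2 hnJ (by omega : h₀' ≤ h + n) ?_ ?_)
        · refine Finset.sum_le_sum fun j' hj' => ?_
          have hj'J : j' ≤ J' - n := by have := Finset.mem_range.mp hj'; omega
          rw [hW]
          exact sum_plaq_le_W F (by omega) (hB0 _) fun q' =>
            IH j' (by omega) (J' + h) (by omega) (by omega) q'
        · rw [hW]
          exact sum_plaq_le_W F (by omega) (hB0 _) fun q' =>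
            IH (J' - n) (by omega) (J' + h) (by omega) (by omega) q'
      -- hence, through the depth `h + 1`: every defect with `n = ⌊J/mbar⌋ ≥ 1` free steps is `≤ (28/3)(¼)^n W_{h+1}`
      have hW1 : ∀ n, 1 ≤ n → 7 / 3 * W_ (h + n) ≤ 28 / 3 * ((1 : ℝ) / 4) ^ n * W_ (h + 1) := fun n hn => by
        have := W_depth_le hC2 hn (by omega : h₀' ≤ h + 1)
        linarith
      have hGb : ∀ J, mbar ≤ J → J ≤ j →
          (gibbsK (F.refine h) ℰp (γ * ((F.L : ℝ)⁻¹) ^ h) J).real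
              (histGoodInt (F.refine h) (θBal F.L (γ * ((F.L : ℝ)⁻¹) ^ h) b₀ (P : ℝ))
                (θBal F.L (γ * ((F.L : ℝ)⁻¹) ^ h) (c * b₀) (P : ℝ) (J / mbar)) J (J / mbar))ᶜ ≤
            28 / 3 * ((1 : ℝ) / 4) ^ (J / mbar) * W_ (h + 1) := by
        intro J hJ hJj
        have hn1 : 1 ≤ J / mbar := Nat.div_pos hJ hm
        have hnJ : J / mbar ≤ J := Nat.div_le_self J mbar
        exact (hdefect J (J / mbar) hn1 hnJ (by omega)).trans (hW1 _ hn1)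
      have hG'b : ∀ J, mbar ≤ J → J < j →
          (gibbsK (F.refine h) ℰp (γ * ((F.L : ℝ)⁻¹) ^ h) (J + 1)).real
              (histGoodInt (F.refine h) (θBal F.L (γ * ((F.L : ℝ)⁻¹) ^ h) b₀ (P : ℝ))
                (θBal F.L (γ * ((F.L : ℝ)⁻¹) ^ h) (c * b₀) (P : ℝ) (J / mbar)) (J + 1) (J / mbar))ᶜ ≤
            28 / 3 * ((1 : ℝ) / 4) ^ (J / mbar) * W_ (h + 1) := by
        intro J hJ hJj
        have hn1 : 1 ≤ J / mbar := Nat.div_pos hJ hm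
        have hnJ : J / mbar ≤ J + 1 := (Nat.div_le_self J mbar).trans (Nat.le_succ J)
        exact (hdefect (J + 1) (J / mbar) hn1 hnJ (by omega)).trans (hW1 _ hn1)
      -- smallness at depth `h ≥ h₀`
      have hWA : 38 * (mbar : ℝ) * W_ (h + 1) ≤ A_ h := hC3 h hh'
      have hAhalf : A_ h ≤ 1 / 2 := hC4 h hh'
      have hm1 : (1 : ℝ) ≤ mbar := by exact_mod_cast hm
      have hWh1 : 0 ≤ W_ (h + 1) := hW0 _
      have hsmall : 28 / 3 * W_ (h + 1) ≤ A_ h := by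
        have h1 : (28 / 3 : ℝ) ≤ 38 * mbar := by linarith only [hm1]
        exact (mul_le_mul_of_nonneg_right h1 hWh1).trans hWA
      have hquarter : ∀ n : ℕ, 28 / 3 * ((1 : ℝ) / 4) ^ n * W_ (h + 1) ≤ 28 / 3 * W_ (h + 1) := fun n => by
        have : ((1 : ℝ) / 4) ^ n ≤ 1 := pow_le_one₀ (by norm_num) (by norm_num)
        exact mul_le_mul_of_nonneg_right (mul_le_of_le_one_right (by norm_num) this) hWh1
      -- THE CHAIN (part 3, abstract form) on `F.refine h`, from `J = mbar` to `J = j`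
      have hchain := real_le_of_crossRatio_chain
        (X := fun J => GaugeField ((F.refine h).P J) 0 (Matrix.specialUnitaryGroup (Fin 2) ℂ))
        (gibbsK (F.refine h) ℰp (γ * ((F.L : ℝ)⁻¹) ^ h))
        (fun J => (unitA (F.refine h) ℰp J) ⁻¹'
          {V | τ J * θBal F.L (γ * ((F.L : ℝ)⁻¹) ^ h) (c * b₀) (P : ℝ) 0 ≤ GaugeGroup.dist1 (GaugeField.plaqHol V pp)})
        (fun J => histGoodInt (F.refine h) (θBal F.L (γ * ((F.L : ℝ)⁻¹) ^ h) b₀ (P : ℝ))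
          (θBal F.L (γ * ((F.L : ℝ)⁻¹) ^ h) (c * b₀) (P : ℝ) (J / mbar)) J (J / mbar))
        (fun J => histGoodInt (F.refine h) (θBal F.L (γ * ((F.L : ℝ)⁻¹) ^ h) b₀ (P : ℝ))
          (θBal F.L (γ * ((F.L : ℝ)⁻¹) ^ h) (c * b₀) (P : ℝ) (J / mbar)) (J + 1) (J / mbar))
        (fun J => measurableSet_histGoodInt (F.refine h) _ _ J _) hρ0 hmj
        (fun J hJ _ => hstep J pp hJ)
        (fun J hJ hJj => ((hGb J hJ hJj.le).trans (hquarter _)).trans (hsmall.trans hAhalf))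
        (Ebar := (unitA (F.refine h) ℰp j) ⁻¹' {V | θ ≤ GaugeGroup.dist1 (GaugeField.plaqHol V pp)})
        (fun V hV => by
          have hV' : θ ≤ GaugeGroup.dist1 (GaugeField.plaqHol (unitA (F.refine h) ℰp j V) pp) := hV
          show τ j * θBal F.L (γ * ((F.L : ℝ)⁻¹) ^ h) (c * b₀) (P : ℝ) 0 ≤
            GaugeGroup.dist1 (GaugeField.plaqHol (unitA (F.refine h) ℰp j V) pp)
          rw [hθh]
          exact (mul_le_of_le_one_left hθ0' (hτ j).2).trans hV')
        (E₀ := (unitA (F.refine h) ℰp mbar) ⁻¹' {V | 2⁻¹ * θ ≤ GaugeGroup.dist1 (GaugeField.plaqHol V pp)})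
        (fun V hV => by
          have hV' : τ mbar * θBal F.L (γ * ((F.L : ℝ)⁻¹) ^ h) (c * b₀) (P : ℝ) 0 ≤
              GaugeGroup.dist1 (GaugeField.plaqHol (unitA (F.refine h) ℰp mbar V) pp) := hV
          rw [hθh] at hV'
          show 2⁻¹ * θ ≤ GaugeGroup.dist1 (GaugeField.plaqHol (unitA (F.refine h) ℰp mbar V) pp)
          have hτ2 : (2 : ℝ)⁻¹ ≤ τ mbar := by rw [← one_div]; exact (hτ mbar).1
          exact (mul_le_mul_of_nonneg_right hτ2 hθ0').trans hV')
      -- name the four quantities of the chain bound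
      obtain ⟨Ssum, hSsum⟩ : ∃ S : ℝ, S = ∑ J ∈ Finset.Ico mbar j, (ρ J + 2 *
          (gibbsK (F.refine h) ℰp (γ * ((F.L : ℝ)⁻¹) ^ h) J).real
            (histGoodInt (F.refine h) (θBal F.L (γ * ((F.L : ℝ)⁻¹) ^ h) b₀ (P : ℝ))
              (θBal F.L (γ * ((F.L : ℝ)⁻¹) ^ h) (c * b₀) (P : ℝ) (J / mbar)) J (J / mbar))ᶜ) := ⟨_, rfl⟩
      obtain ⟨X₀, hX₀⟩ : ∃ X : ℝ, X = (gibbsK (F.refine h) ℰp (γ * ((F.L : ℝ)⁻¹) ^ h) mbar).real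
          ((unitA (F.refine h) ℰp mbar) ⁻¹' {V | 2⁻¹ * θ ≤ GaugeGroup.dist1 (GaugeField.plaqHol V pp)}) := ⟨_, rfl⟩
      obtain ⟨Sd, hSd⟩ : ∃ S : ℝ, S = ∑ J ∈ Finset.Ico mbar j,
          (gibbsK (F.refine h) ℰp (γ * ((F.L : ℝ)⁻¹) ^ h) (J + 1)).real
            (histGoodInt (F.refine h) (θBal F.L (γ * ((F.L : ℝ)⁻¹) ^ h) b₀ (P : ℝ))
              (θBal F.L (γ * ((F.L : ℝ)⁻¹) ^ h) (c * b₀) (P : ℝ) (J / mbar)) (J + 1) (J / mbar))ᶜ := ⟨_, rfl⟩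
      obtain ⟨cj, hcj⟩ : ∃ X : ℝ, X = (gibbsK (F.refine h) ℰp (γ * ((F.L : ℝ)⁻¹) ^ h) j).real
          (histGoodInt (F.refine h) (θBal F.L (γ * ((F.L : ℝ)⁻¹) ^ h) b₀ (P : ℝ))
            (θBal F.L (γ * ((F.L : ℝ)⁻¹) ^ h) (c * b₀) (P : ℝ) (j / mbar)) j (j / mbar))ᶜ := ⟨_, rfl⟩
      rw [← hSsum, ← hX₀, ← hSd, ← hcj] at hchain
      have hIco : ∑ J ∈ Finset.Ico mbar j, ((1 : ℝ) / 4) ^ (J / mbar) ≤ 4 / 3 * mbar := sum_Ico_quarter_pow_div_le hm mbar j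
      -- (a) the slack `Σ ρ ≤ R p_h (m + h + 1)^q = Rt h` and the defects of runs `J`: `Ssum ≤ Rt h + 1`
      have hρle : ∑ J ∈ Finset.Ico mbar j, ρ J ≤ Rt h := by
        refine (Finset.sum_le_sum_of_subset_of_nonneg (fun J hJ => Finset.mem_range.mpr (Finset.mem_Ico.mp hJ).2)
          (fun J _ _ => hρ0 J)).trans ((hρsum j).trans (le_of_eq ?_))
        rw [hp_eq, hRt, T3Family.refine_m]; push_cast; ring
      have hSsum_le : Ssum ≤ Rt h + 1 := by
        have h2 : ∑ J ∈ Finset.Ico mbar j, 2 * (gibbsK (F.refine h) ℰp (γ * ((F.L : ℝ)⁻¹) ^ h) J).real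
            (histGoodInt (F.refine h) (θBal F.L (γ * ((F.L : ℝ)⁻¹) ^ h) b₀ (P : ℝ))
              (θBal F.L (γ * ((F.L : ℝ)⁻¹) ^ h) (c * b₀) (P : ℝ) (J / mbar)) J (J / mbar))ᶜ ≤
            (2 * (28 / 3) * W_ (h + 1)) * ∑ J ∈ Finset.Ico mbar j, ((1 : ℝ) / 4) ^ (J / mbar) := by
          rw [Finset.mul_sum]
          exact Finset.sum_le_sum fun J hJ => by
            have hJ' := Finset.mem_Ico.mp hJ
            have := hGb J hJ'.1 hJ'.2.le
            linarith
        have h3 : (2 * (28 / 3) * W_ (h + 1)) * ∑ J ∈ Finset.Ico mbar j, ((1 : ℝ) / 4) ^ (J / mbar) ≤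
            (2 * (28 / 3) * W_ (h + 1)) * (4 / 3 * mbar) := mul_le_mul_of_nonneg_left hIco (by positivity)
        have hmW : 0 ≤ (mbar : ℝ) * W_ (h + 1) := by positivity
        rw [hSsum, Finset.sum_add_distrib]
        linarith only [hρle, h2, h3, hWA, hAhalf, hmW]
      -- (b) the base at threshold `θ/2`: brute force at profile `c b₀/2`, read back on `F` (part 2)
      have hX₀_le : X₀ ≤ A_ h := by
        have h1 := hbaseA (mbar + h) mbar (Nat.le_add_right mbar h) le_rfl
          ((plaqShift (sitesPerDir_level_refine_unit F h mbar)).symm pp)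
        rw [Nat.add_sub_cancel_left mbar h, ← hθdef] at h1
        rw [hX₀]
        exact (gibbsK_refine_real_unitEvent_eq F hγ.le h mbar (2⁻¹ * θ) pp).trans_le h1
      -- (c) the defects of runs `J + 1`
      have hSd_le : Sd ≤ A_ h := by
        have h2 : ∑ J ∈ Finset.Ico mbar j, (gibbsK (F.refine h) ℰp (γ * ((F.L : ℝ)⁻¹) ^ h) (J + 1)).real
            (histGoodInt (F.refine h) (θBal F.L (γ * ((F.L : ℝ)⁻¹) ^ h) b₀ (P : ℝ))
              (θBal F.L (γ * ((F.L : ℝ)⁻¹) ^ h) (c * b₀) (P : ℝ) (J / mbar)) (J + 1) (J / mbar))ᶜ ≤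
            (28 / 3 * W_ (h + 1)) * ∑ J ∈ Finset.Ico mbar j, ((1 : ℝ) / 4) ^ (J / mbar) := by
          rw [Finset.mul_sum]
          exact Finset.sum_le_sum fun J hJ => by
            have hJ' := Finset.mem_Ico.mp hJ
            have := hG'b J hJ'.1 hJ'.2
            linarith
        have h3 : (28 / 3 * W_ (h + 1)) * ∑ J ∈ Finset.Ico mbar j, ((1 : ℝ) / 4) ^ (J / mbar) ≤
            (28 / 3 * W_ (h + 1)) * (4 / 3 * mbar) := mul_le_mul_of_nonneg_left hIco (by positivity)
        have hmW : 0 ≤ (mbar : ℝ) * W_ (h + 1) := by positivity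
        rw [hSd]
        linarith only [h2, h3, hWA, hmW]
      -- (d) the last defect
      have hcj_le : cj ≤ A_ h := by rw [hcj]; exact ((hGb j hmj le_rfl).trans (hquarter _)).trans hsmall
      have hX₀0 : 0 ≤ X₀ := by rw [hX₀]; exact measureReal_nonneg
      have hSd0 : 0 ≤ Sd := by rw [hSd]; exact Finset.sum_nonneg fun _ _ => measureReal_nonneg
      -- assemble: `e^{Ssum}(X₀ + Sd) + cj ≤ e^{Rt h + 1}·2A_h + A_h ≤ 3 e^{Rt h + 1} A_h = B_h`
      refine hchain.trans ?_
      rw [hB h]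
      have he : Real.exp Ssum ≤ Real.exp (Rt h + 1) := Real.exp_le_exp.mpr hSsum_le
      have hprod : Real.exp Ssum * (X₀ + Sd) ≤ Real.exp (Rt h + 1) * (A_ h + A_ h) :=
        mul_le_mul he (add_le_add hX₀_le hSd_le) (by linarith only [hX₀0, hSd0]) (Real.exp_pos _).le
      have hA3 : A_ h ≤ Real.exp (Rt h + 1) * A_ h := le_mul_of_one_le_left (hA0 h).le (hexp1 h)
      linarith only [hprod, hcj_le, hA3]
  -- THE OUTPUT: Gaussian shape at depths `≥ h₀` (part 4 (iv)), trivial bound below `h₀`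
  obtain ⟨a', ha'def⟩ : ∃ a' : ℝ, a' = a / (2 * c ^ 2) := ⟨_, rfl⟩
  have ha' : 0 < a' := by rw [ha'def]; positivity
  have hpc : ∀ i, B10.pFun (c * b₀) (P : ℝ) (Real.sqrt (γ * ((F.L : ℝ)⁻¹) ^ i)) = c * p_ i := fun i => by
    rw [pFun_mul, hp_eq]
  have ha'p : ∀ i, a' * (c * p_ i) ^ 2 = a / 2 * p_ i ^ 2 := fun i => by
    rw [ha'def]; field_simp
  refine ⟨C₁ + Real.exp (a / 2 * p_ h₀ ^ 2), A, a', by positivity, ha', fun K j hjK qq => ?_⟩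
  rw [hpc, ha'p, hβexp, ← Real.exp_nat_mul]
  by_cases hh : h₀ ≤ K - j
  · -- deep: the claim, then the Gaussian absorption
    refine ((claim j K hjK hh qq).trans (hC5 (K - j) (hh₀'.trans hh))).trans ?_
    exact mul_le_mul_of_nonneg_right (mul_le_mul_of_nonneg_right (le_add_of_nonneg_right (Real.exp_pos _).le)
      (Real.exp_pos _).le) (Real.exp_pos _).le
  · -- shallow: the mass is `≤ 1 ≤ e^{(a/2)(p_{h₀}² − p_{K−j}²)}·β^A`
    have hKj : K - j ≤ h₀ := by omega
    have h1 : (gibbsK F ℰp γ K).real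
        {U | θBal F.L γ (c * b₀) (P : ℝ) (K - j) ≤ GaugeGroup.dist1 (GaugeField.plaqHol
          (Averaging.iter (fun i => BlockAveraging.blockAvg (P := F.P K) (j := i) ℰp) j U) qq)} ≤ 1 := measureReal_le_one
    have h2 : (1 : ℝ) ≤ Real.exp (A * ((K - j : ℕ) * Real.log F.L - Real.log γ)) := by
      rw [Real.exp_nat_mul, ← hβexp]; exact one_le_pow₀ (hβ1 _)
    have h3 : (1 : ℝ) ≤ Real.exp (a / 2 * p_ h₀ ^ 2) * Real.exp (-(a / 2 * p_ (K - j) ^ 2)) := by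
      rw [← Real.exp_add]
      refine Real.one_le_exp ?_
      have hsq : p_ (K - j) ^ 2 ≤ p_ h₀ ^ 2 := pow_le_pow_left₀ (hp0 _) (hpmono _ _ hKj) 2
      have := mul_le_mul_of_nonneg_left hsq (by positivity : (0 : ℝ) ≤ a / 2)
      linarith only [this]
    have h4 : 0 ≤ C₁ * Real.exp (A * ((K - j : ℕ) * Real.log F.L - Real.log γ)) * Real.exp (-(a / 2 * p_ (K - j) ^ 2)) := by
      positivity
    calc (gibbsK F ℰp γ K).real
          {U | θBal F.L γ (c * b₀) (P : ℝ) (K - j) ≤ GaugeGroup.dist1 (GaugeField.plaqHol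
            (Averaging.iter (fun i => BlockAveraging.blockAvg (P := F.P K) (j := i) ℰp) j U) qq)} ≤ 1 := h1
      _ ≤ (Real.exp (a / 2 * p_ h₀ ^ 2) * Real.exp (-(a / 2 * p_ (K - j) ^ 2))) *
            Real.exp (A * ((K - j : ℕ) * Real.log F.L - Real.log γ)) := one_le_mul_of_one_le_of_one_le h3 h2
      _ = Real.exp (a / 2 * p_ h₀ ^ 2) * (Real.exp (A * ((K - j : ℕ) * Real.log F.L - Real.log γ)) *
            Real.exp (-(a / 2 * p_ (K - j) ^ 2))) := by ring
      _ ≤ (C₁ + Real.exp (a / 2 * p_ h₀ ^ 2)) * (Real.exp (A * ((K - j : ℕ) * Real.log F.L - Real.log γ)) *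
            Real.exp (-(a / 2 * p_ (K - j) ^ 2))) :=
          mul_le_mul_of_nonneg_right (le_add_of_nonneg_left hC₁.le) (by positivity)
      _ = (C₁ + Real.exp (a / 2 * p_ h₀ ^ 2)) * Real.exp (A * ((K - j : ℕ) * Real.log F.L - Real.log γ)) *
            Real.exp (-(a / 2 * p_ (K - j) ^ 2)) := by ring

end Summit.QuantumFields.YangMills.Theorems.HistoryTailOfLocalStability

end
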